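import Summits.KontsevichZagierPeriods.KontsevichZagierPeriods.Theorems.LinRedNormalFormArrangementNormalFormStubIntegrateOutLowOrderCells

/-!
# `stub_reRead` (crux `ArrangementNormalForm`, line `janus-bands`, skeleton v3)

`G₁ b k → closure (JJ b (k + 1))`: a rebased Janus band representation with base `(x', y)` and
`k` fibres whose rational part depends on `y` only through ONE simple pole `1 / (y − ℓ₂(x'))`
(`n₂ = 1`, hence `n₁ = 0`), whose fibre letters are `y`-free and whose affine fibre bounds are
`y`-free or `y` itself, is congruent modulo the KZ moves to a `ℤ`-combination of Janus band
representations with base `x'` and EXACTLY `k + 1` fibres: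

1. transport along `b + 1 + k = b + (k + 1)` (`IntegrateOutLow.of_cast`): `y` keeps its index `b`
   and is re-read as the first fibre coordinate, with letter `ℓ₂(x')`; the rows of the base cell
   involving `y` are solved for `y`, the bound "`y` itself" becomes the fibre `y`, `y`-free
   bounds and letters restrict to the base `x'`; the bounds `−R < y < R` (`R` larger than the
   diameter of the domain) make every fibre two-sided constrained;
2. total-order refinement (rule 1a, `IntegrateOutLow.of_sub_sum_cell_mem_relations`): on the piece
   of a chain of players consistent with the constraints every fibre has a unique lower and upper
   neighbour (`IntegrateOutLow.exists_inter_chain_eq`), inconsistent chains give empty pieces —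
   `ReRead.orderCells_JJ`, the fibre-counted version of `integrateOutLow_orderCells`.

No integrand is split and no coordinate is integrated: every piece is a restriction of the
transported input, hence absolutely convergent. Adapted from the landed v2 stub
`stub_integrateOutLow` (no unfolding step is needed here since `n₁ = 0`).
-/

noncomputable section

open MeasureTheory Set MvPolynomial
open Literature.NumberTheory.Transcendental Literature.ModelTheory.ExponentialFields

namespace Summit.KontsevichZagierPeriods.ArrangementNormalForm.JanusBands

namespace ReRead

open IntegrateOutLow

/-- **Order-constrained Janus representations are sums of Janus band representations with the
same number of fibres** (fibre-counted version of `integrateOutLow_orderCells`): dissect by the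
total orders of the players (rule 1a; ties are null); on the piece of a consistent chain every
fibre has a unique lower and upper neighbour and the other comparisons are rows of the base
cell; inconsistent chains give empty pieces. The pieces keep the dimension `b + K`. -/
theorem orderCells_JJ (b K m : ℕ) (s : KZ.IntegralRep (b + K))
    (C : Finset ((Fin K ⊕ ((Fin b → ℚ) × ℚ)) × (Fin K ⊕ ((Fin b → ℚ) × ℚ))))
    (L : Fin m → (Fin b → ℚ) × ℚ) (e : Fin m → ℕ) (p : MvPolynomial (Fin b) ℚ)
    (a : Fin K → Option ((Fin b → ℚ) × ℚ)) (hbd : Bornology.IsBounded s.domain)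
    (hlu : ∀ v, (∃ q ∈ C, q.2 = Sum.inl v) ∧ (∃ q ∈ C, q.1 = Sum.inl v))
    (hdom : s.domain = {z | ∀ q ∈ C, Sum.elim (fun j => z (Fin.natAdd b j))
      (fun c => ∑ i', (c.1 i' : ℝ) * z (Fin.castAdd K i') + (c.2 : ℝ)) q.1 <
      Sum.elim (fun j => z (Fin.natAdd b j))
      (fun c => ∑ i', (c.1 i' : ℝ) * z (Fin.castAdd K i') + (c.2 : ℝ)) q.2})
    (hint : EqOn s.integrand (fun z => MvPolynomial.aeval (fun i => z (Fin.castAdd K i)) p /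
      (∏ j, (∑ i, ((L j).1 i : ℝ) * z (Fin.castAdd K i) + ((L j).2 : ℝ)) ^ e j) *
      ∏ i, (a i).elim 1 (fun c => 1 / (z (Fin.natAdd b i) -
      (∑ i', (c.1 i' : ℝ) * z (Fin.castAdd K i') + (c.2 : ℝ))))) s.domain) :
    ∃ c ∈ AddSubgroup.closure {w : KZ.FormalRep | ∃ (m m' : ℕ) (s : KZ.IntegralRep (b + K))
      (M : Fin m' → (Fin b → ℚ) × ℚ) (L : Fin m → (Fin b → ℚ) × ℚ) (e : Fin m → ℕ)
      (p : MvPolynomial (Fin b) ℚ) (a : Fin K → Option ((Fin b → ℚ) × ℚ))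
      (lo hi : Fin K → Fin K ⊕ ((Fin b → ℚ) × ℚ)), Bornology.IsBounded s.domain ∧
      s.domain = {z | (∀ j, 0 < ∑ i, ((M j).1 i : ℝ) * z (Fin.castAdd K i) + ((M j).2 : ℝ)) ∧
      ∀ i, Sum.elim (fun j => z (Fin.natAdd b j))
      (fun c => ∑ i', (c.1 i' : ℝ) * z (Fin.castAdd K i') + (c.2 : ℝ)) (lo i) <
      z (Fin.natAdd b i) ∧ z (Fin.natAdd b i) < Sum.elim (fun j => z (Fin.natAdd b j))
      (fun c => ∑ i', (c.1 i' : ℝ) * z (Fin.castAdd K i') + (c.2 : ℝ)) (hi i)} ∧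
      EqOn s.integrand (fun z => MvPolynomial.aeval (fun i => z (Fin.castAdd K i)) p /
      (∏ j, (∑ i, ((L j).1 i : ℝ) * z (Fin.castAdd K i) + ((L j).2 : ℝ)) ^ e j) *
      ∏ i, (a i).elim 1 (fun c => 1 / (z (Fin.natAdd b i) -
      (∑ i', (c.1 i' : ℝ) * z (Fin.castAdd K i') + (c.2 : ℝ))))) s.domain ∧ w = KZ.of s},
      KZ.of s - c ∈ KZ.relations := by
  classical
  set PV : Fin K ⊕ ((Fin b → ℚ) × ℚ) → (Fin (b + K) → ℝ) → ℝ := fun u z =>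
    Sum.elim (fun j => z (Fin.natAdd b j))
      (fun c => ∑ i', (c.1 i' : ℝ) * z (Fin.castAdd K i') + (c.2 : ℝ)) u with hPV
  have hdom' : s.domain = {z | ∀ q ∈ C, PV q.1 z < PV q.2 z} := hdom
  set A : Finset ((Fin b → ℚ) × ℚ) :=
    C.biUnion fun q => q.1.getRight?.toFinset ∪ q.2.getRight?.toFinset with hA_def
  have hA : ∀ q ∈ C, ∀ d, (q.1 = Sum.inr d ∨ q.2 = Sum.inr d) → d ∈ A := by
    intro q hq d h
    rw [hA_def, Finset.mem_biUnion]
    refine ⟨q, hq, ?_⟩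
    rcases h with h | h <;> simp [h]
  set P : Fin K ⊕ A → MvPolynomial (Fin (b + K)) ℚ := fun x =>
    Sum.elim (fun v => (X (Fin.natAdd b v) : MvPolynomial (Fin (b + K)) ℚ))
      (fun d => rename (Fin.castAdd K) (∑ i, MvPolynomial.C (d.1 i) * X i + MvPolynomial.C d.2))
      (Sum.map id Subtype.val x) with hP_def
  have hval : ∀ x z, aeval z (P x) = PV (Sum.map id Subtype.val x) z := fun x z =>
    aeval_player _ z
  have hP : ∀ x y, x ≠ y → ∃ z, aeval z (P x) ≠ aeval z (P y) := fun x y hxy => by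
    obtain ⟨z, hz⟩ := player_ne (b := b) (K := K) (fun h => hxy
      (Sum.map_injective.2 ⟨fun _ _ h => h, Subtype.val_injective⟩ h))
    exact ⟨z, by rwa [hval, hval]⟩
  have hsplit := of_sub_sum_cell_mem_relations P hP s
  have hcell : ∀ σ : Fin (Fintype.card (Fin K ⊕ A)) ≃ Fin K ⊕ A,
      {z : Fin (b + K) → ℝ | StrictMono fun i => aeval z (P (σ i))} =
      {z | StrictMono fun i => PV (Sum.map id Subtype.val (σ i)) z} := fun σ => by
    simp_rw [hval]
  set piece := fun σ : Fin (Fintype.card (Fin K ⊕ A)) ≃ Fin K ⊕ A =>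
    s.restrict (s.domain ∩ {z | StrictMono fun i => aeval z (P (σ i))})
      (s.isSemialgebraic_domain.inter (isSemialgebraic_cell P σ)) inter_subset_left with hpiece
  set good := fun σ : Fin (Fintype.card (Fin K ⊕ A)) ≃ Fin K ⊕ A =>
    ∀ q ∈ C, ∃ x₁ x₂ : Fin K ⊕ A, Sum.map id Subtype.val x₁ = q.1 ∧
      Sum.map id Subtype.val x₂ = q.2 ∧ σ.symm x₁ < σ.symm x₂ with hgood_def
  have hgood : ∀ σ, good σ →
      KZ.of (piece σ) ∈ {w : KZ.FormalRep | ∃ (m m' : ℕ) (s : KZ.IntegralRep (b + K))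
        (M : Fin m' → (Fin b → ℚ) × ℚ) (L : Fin m → (Fin b → ℚ) × ℚ) (e : Fin m → ℕ)
        (p : MvPolynomial (Fin b) ℚ) (a : Fin K → Option ((Fin b → ℚ) × ℚ))
        (lo hi : Fin K → Fin K ⊕ ((Fin b → ℚ) × ℚ)), Bornology.IsBounded s.domain ∧
        s.domain = {z | (∀ j, 0 < ∑ i, ((M j).1 i : ℝ) * z (Fin.castAdd K i) + ((M j).2 : ℝ)) ∧
        ∀ i, Sum.elim (fun j => z (Fin.natAdd b j))
        (fun c => ∑ i', (c.1 i' : ℝ) * z (Fin.castAdd K i') + (c.2 : ℝ)) (lo i) <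
        z (Fin.natAdd b i) ∧ z (Fin.natAdd b i) < Sum.elim (fun j => z (Fin.natAdd b j))
        (fun c => ∑ i', (c.1 i' : ℝ) * z (Fin.castAdd K i') + (c.2 : ℝ)) (hi i)} ∧
        EqOn s.integrand (fun z => MvPolynomial.aeval (fun i => z (Fin.castAdd K i)) p /
        (∏ j, (∑ i, ((L j).1 i : ℝ) * z (Fin.castAdd K i) + ((L j).2 : ℝ)) ^ e j) *
        ∏ i, (a i).elim 1 (fun c => 1 / (z (Fin.natAdd b i) -
        (∑ i', (c.1 i' : ℝ) * z (Fin.castAdd K i') + (c.2 : ℝ))))) s.domain ∧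
        w = KZ.of s} := by
    intro σ hσ
    obtain ⟨lo', hi', hEq⟩ := exists_inter_chain_eq PV A C σ hσ hlu
    refine ⟨m, Fintype.card (Fin K ⊕ A), piece σ, fun i =>
      if h : i.val + 1 < Fintype.card (Fin K ⊕ A) then
        Sum.elim (fun _ => ((0 : Fin b → ℚ), (1 : ℚ))) (fun d => Sum.elim (fun _ => (0, 1))
          (fun d' => (d'.1 - d.1, d'.2 - d.2)) (Sum.map id Subtype.val (σ ⟨i.val + 1, h⟩)))
          (Sum.map id Subtype.val (σ i)) else (0, 1),
      L, e, p, a, lo', hi', hbd.subset inter_subset_left, ?_, hint.mono inter_subset_left, rfl⟩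
    show s.domain ∩ {z | StrictMono fun i => aeval z (P (σ i))} = _
    rw [hdom', hcell σ, hEq]
    ext z
    simp only [mem_setOf_eq]
    refine and_congr ⟨fun h j => ?_, fun h i hi d d' h1 h2 => ?_⟩ Iff.rfl
    · by_cases hj : j.val + 1 < Fintype.card (Fin K ⊕ A)
      · rw [dif_pos hj]
        rcases h1 : Sum.map id Subtype.val (σ j) with v | d
        · simp
        · rcases h2 : Sum.map id Subtype.val (σ ⟨j.val + 1, hj⟩) with v' | d'
          · simp
          · have hlt := h j hj d d' h1 h2
            simp only [Sum.elim_inr, Pi.sub_apply, sub_row_pos_iff]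
            exact hlt
      · rw [dif_neg hj]
        simp
    · have hr := h i
      rw [dif_pos hi, h1, h2] at hr
      simp only [Sum.elim_inr, Pi.sub_apply, sub_row_pos_iff] at hr
      exact hr
  have hbad : ∀ σ, ¬ good σ → KZ.of (piece σ) ∈ KZ.relations := by
    intro σ hσ
    refine KZ.of_mem_relations_of_volume_eq_zero _ ?_
    show volume (s.domain ∩ {z | StrictMono fun i => aeval z (P (σ i))}) = 0
    rw [hdom', hcell σ, inter_chain_eq_empty PV A C hA σ hσ, measure_empty]
  refine ⟨∑ σ ∈ Finset.univ.filter good, KZ.of (piece σ), AddSubgroup.sum_mem _ fun σ hσ =>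
      AddSubgroup.subset_closure (hgood σ (Finset.mem_filter.1 hσ).2), ?_⟩
  rw [← Finset.sum_filter_add_sum_filter_not Finset.univ good] at hsplit
  have hb : ∑ σ ∈ Finset.univ.filter (fun σ => ¬ good σ), KZ.of (piece σ) ∈ KZ.relations :=
    sum_mem fun σ hσ => hbad σ (Finset.mem_filter.1 hσ).2
  convert KZ.relations.add_mem hsplit hb using 1
  abel

variable {b k m m' : ℕ} (s : KZ.IntegralRep (b + 1 + k)) (L : Fin m → (Fin b → ℚ) × ℚ)
  (e : Fin m → ℕ) (p : MvPolynomial (Fin b) ℚ) (ℓ₁ ℓ₂ : (Fin b → ℚ) × ℚ)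
  (a : Fin k → Option ((Fin (b + 1) → ℚ) × ℚ)) (M : Fin m' → (Fin (b + 1) → ℚ) × ℚ)
  (lo hi : Fin k → Fin k ⊕ ((Fin (b + 1) → ℚ) × ℚ))

/-- **Re-reading `y` as the first fibre.** A `G₁ b k` representation, transported to dimension
`b + (k + 1)`, is an order-constrained Janus representation over the base `x'` with `k + 1`
fibres (rows of the base cell involving `y` are solved for `y`; `y`-free bounds and letters
restrict to the base; the bound "`y` itself" becomes the fibre `y`, whose letter is `ℓ₂(x')`),
hence a sum of Janus band representations with `k + 1` fibres (`orderCells_JJ`). -/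
theorem exists_JJ (ha : ∀ i c, a i = some c → c.1 (Fin.last b) = 0)
    (hlohi : ∀ i c, (lo i = Sum.inr c ∨ hi i = Sum.inr c) →
      (c.1 (Fin.last b) = 0 ∨ c = (Pi.single (Fin.last b) 1, 0)))
    (hbd : Bornology.IsBounded s.domain)
    (hdom : s.domain = {z | (∀ j, 0 < ∑ i, ((M j).1 i : ℝ) * z (Fin.castAdd k i) + ((M j).2 : ℝ)) ∧
      ∀ i, Sum.elim (fun j => z (Fin.natAdd (b + 1) j))
      (fun c => ∑ i', (c.1 i' : ℝ) * z (Fin.castAdd k i') + (c.2 : ℝ)) (lo i) <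
      z (Fin.natAdd (b + 1) i) ∧ z (Fin.natAdd (b + 1) i) <
      Sum.elim (fun j => z (Fin.natAdd (b + 1) j))
      (fun c => ∑ i', (c.1 i' : ℝ) * z (Fin.castAdd k i') + (c.2 : ℝ)) (hi i)})
    (hint : EqOn s.integrand (fun z => MvPolynomial.aeval (fun i => z (Fin.castAdd k
      (Fin.castSucc i))) p / (∏ j, (∑ i, ((L j).1 i : ℝ) * z (Fin.castAdd k (Fin.castSucc i)) +
      ((L j).2 : ℝ)) ^ e j) * ((z (Fin.castAdd k (Fin.last b)) - (∑ i, (ℓ₁.1 i : ℝ) *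
      z (Fin.castAdd k (Fin.castSucc i)) + (ℓ₁.2 : ℝ))) ^ 0 / (z (Fin.castAdd k (Fin.last b)) -
      (∑ i, (ℓ₂.1 i : ℝ) * z (Fin.castAdd k (Fin.castSucc i)) + (ℓ₂.2 : ℝ))) ^ 1) *
      ∏ i, (a i).elim 1 (fun c => 1 / (z (Fin.natAdd (b + 1) i) -
      (∑ i', (c.1 i' : ℝ) * z (Fin.castAdd k i') + (c.2 : ℝ))))) s.domain) :
    ∃ c ∈ AddSubgroup.closure {w : KZ.FormalRep | ∃ (m m' : ℕ) (s : KZ.IntegralRep (b + (k + 1)))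
      (M : Fin m' → (Fin b → ℚ) × ℚ) (L : Fin m → (Fin b → ℚ) × ℚ) (e : Fin m → ℕ)
      (p : MvPolynomial (Fin b) ℚ) (a : Fin (k + 1) → Option ((Fin b → ℚ) × ℚ))
      (lo hi : Fin (k + 1) → Fin (k + 1) ⊕ ((Fin b → ℚ) × ℚ)), Bornology.IsBounded s.domain ∧
      s.domain = {z | (∀ j, 0 < ∑ i, ((M j).1 i : ℝ) * z (Fin.castAdd (k + 1) i) +
      ((M j).2 : ℝ)) ∧ ∀ i, Sum.elim (fun j => z (Fin.natAdd b j))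
      (fun c => ∑ i', (c.1 i' : ℝ) * z (Fin.castAdd (k + 1) i') + (c.2 : ℝ)) (lo i) <
      z (Fin.natAdd b i) ∧ z (Fin.natAdd b i) < Sum.elim (fun j => z (Fin.natAdd b j))
      (fun c => ∑ i', (c.1 i' : ℝ) * z (Fin.castAdd (k + 1) i') + (c.2 : ℝ)) (hi i)} ∧
      EqOn s.integrand (fun z => MvPolynomial.aeval (fun i => z (Fin.castAdd (k + 1) i)) p /
      (∏ j, (∑ i, ((L j).1 i : ℝ) * z (Fin.castAdd (k + 1) i) + ((L j).2 : ℝ)) ^ e j) *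
      ∏ i, (a i).elim 1 (fun c => 1 / (z (Fin.natAdd b i) -
      (∑ i', (c.1 i' : ℝ) * z (Fin.castAdd (k + 1) i') + (c.2 : ℝ))))) s.domain ∧ w = KZ.of s},
      KZ.of s - c ∈ KZ.relations := by
  obtain ⟨R₀, hR₀⟩ := hbd.exists_norm_le
  have hc : b + 1 + k = b + (k + 1) := by omega
  have cx : ∀ i : Fin b, Fin.cast hc (Fin.castAdd k (Fin.castSucc i)) = Fin.castAdd (k + 1) i :=
    fun i => Fin.ext (by simp)
  have cy : Fin.cast hc (Fin.castAdd k (Fin.last b)) = Fin.natAdd b (0 : Fin (k + 1)) :=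
    Fin.ext (by simp)
  have ct : ∀ i : Fin k, Fin.cast hc (Fin.natAdd (b + 1) i) = Fin.natAdd b i.succ :=
    fun i => Fin.ext (by simp; omega)
  set PV : Fin (k + 1) ⊕ ((Fin b → ℚ) × ℚ) → (Fin (b + (k + 1)) → ℝ) → ℝ := fun u w =>
    Sum.elim (fun j => w (Fin.natAdd b j))
      (fun c => ∑ i', (c.1 i' : ℝ) * w (Fin.castAdd (k + 1) i') + (c.2 : ℝ)) u with hPV
  set y0 : Fin (k + 1) := 0 with hy0
  set bnd : Fin k ⊕ ((Fin (b + 1) → ℚ) × ℚ) → Fin (k + 1) ⊕ ((Fin b → ℚ) × ℚ) :=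
    Sum.elim (fun j => Sum.inl j.succ)
      (fun c => if c = (Pi.single (Fin.last b) 1, 0) then Sum.inl y0
        else Sum.inr (fun i => c.1 (Fin.castSucc i), c.2)) with hbnd
  set rowC : Fin m' → (Fin (k + 1) ⊕ ((Fin b → ℚ) × ℚ)) × (Fin (k + 1) ⊕ ((Fin b → ℚ) × ℚ)) :=
    fun j => if 0 < (M j).1 (Fin.last b) then
        (Sum.inr (fun i => -(M j).1 (Fin.castSucc i) / (M j).1 (Fin.last b),
          -(M j).2 / (M j).1 (Fin.last b)), Sum.inl y0)
      else if (M j).1 (Fin.last b) < 0 then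
        (Sum.inl y0, Sum.inr (fun i => -(M j).1 (Fin.castSucc i) / (M j).1 (Fin.last b),
          -(M j).2 / (M j).1 (Fin.last b)))
      else (Sum.inr (0, 0), Sum.inr (fun i => (M j).1 (Fin.castSucc i), (M j).2)) with hrowC
  set R : ℕ := ⌈R₀⌉₊ + 1 with hR
  set Cs : Finset ((Fin (k + 1) ⊕ ((Fin b → ℚ) × ℚ)) × (Fin (k + 1) ⊕ ((Fin b → ℚ) × ℚ))) :=
    Finset.univ.image rowC ∪
    Finset.univ.image (fun i => (bnd (lo i), Sum.inl (Fin.succ i))) ∪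
    Finset.univ.image (fun i => (Sum.inl (Fin.succ i), bnd (hi i))) ∪
    {(Sum.inr (0, -(R : ℚ)), Sum.inl y0), (Sum.inl y0, Sum.inr (0, (R : ℚ)))} with hCs
  have hrow : ∀ w j, PV (rowC j).1 w < PV (rowC j).2 w ↔
      0 < ∑ i, ((M j).1 (Fin.castSucc i) : ℝ) * w (Fin.castAdd (k + 1) i) +
        ((M j).1 (Fin.last b) : ℝ) * w (Fin.natAdd b y0) + ((M j).2 : ℝ) := by
    intro w j
    have hq : ∀ x : Fin b → ℚ, ∀ q c : ℚ,
        ∑ i, ((-x i / q : ℚ) : ℝ) * w (Fin.castAdd (k + 1) i) +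
        ((-c / q : ℚ) : ℝ) = -(∑ i, (x i : ℝ) * w (Fin.castAdd (k + 1) i) + c) / q := by
      intro x q c
      push_cast
      simp only [neg_add, add_div, Finset.sum_div, ← Finset.sum_neg_distrib]
      exact congrArg₂ (· + ·) (Finset.sum_congr rfl fun i _ => by ring) (by ring)
    simp only [hrowC]
    split_ifs with h1 h2
    · have h1' : (0 : ℝ) < (M j).1 (Fin.last b) := by exact_mod_cast h1
      simp only [hPV, Sum.elim_inr, Sum.elim_inl, hq, div_lt_iff₀ h1']
      constructor <;> intro h <;> linarith
    · have h2' : ((M j).1 (Fin.last b) : ℝ) < 0 := by exact_mod_cast h2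
      simp only [hPV, Sum.elim_inr, Sum.elim_inl, hq, lt_div_iff_of_neg h2']
      constructor <;> intro h <;> linarith
    · have h0 : (M j).1 (Fin.last b) = 0 := le_antisymm (not_lt.1 h1) (not_lt.1 h2)
      simp [hPV, h0]
  have hbv : ∀ w u,
      (∀ c, u = Sum.inr c → c.1 (Fin.last b) = 0 ∨ c = (Pi.single (Fin.last b) 1, 0)) →
      PV (bnd u) w = Sum.elim (fun j => w (Fin.natAdd b (Fin.succ j)))
        (fun c => ∑ i, (c.1 (Fin.castSucc i) : ℝ) * w (Fin.castAdd (k + 1) i) +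
          (c.1 (Fin.last b) : ℝ) * w (Fin.natAdd b y0) + (c.2 : ℝ)) u := by
    intro w u hu
    rcases u with j | c
    · simp [hbnd, hPV]
    · rcases hu c rfl with h0 | h1
      · have hne : c ≠ (Pi.single (Fin.last b) 1, 0) := fun h => by
          rw [h] at h0; simp at h0
        simp [hbnd, hPV, hne, h0]
      · subst h1
        simp [hbnd, hPV]
  have hG2 : ∀ w : Fin (b + (k + 1)) → ℝ, (fun i => w (Fin.cast hc i)) ∈ s.domain ↔
      (∀ j, 0 < ∑ i, ((M j).1 (Fin.castSucc i) : ℝ) * w (Fin.castAdd (k + 1) i) +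
        ((M j).1 (Fin.last b) : ℝ) * w (Fin.natAdd b y0) + ((M j).2 : ℝ)) ∧
      ∀ i, Sum.elim (fun j => w (Fin.natAdd b (Fin.succ j)))
        (fun c => ∑ i, (c.1 (Fin.castSucc i) : ℝ) * w (Fin.castAdd (k + 1) i) +
          (c.1 (Fin.last b) : ℝ) * w (Fin.natAdd b y0) + (c.2 : ℝ)) (lo i) <
        w (Fin.natAdd b i.succ) ∧ w (Fin.natAdd b i.succ) <
        Sum.elim (fun j => w (Fin.natAdd b (Fin.succ j)))
        (fun c => ∑ i, (c.1 (Fin.castSucc i) : ℝ) * w (Fin.castAdd (k + 1) i) +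
          (c.1 (Fin.last b) : ℝ) * w (Fin.natAdd b y0) + (c.2 : ℝ)) (hi i) := by
    intro w
    rw [hdom]
    simp only [mem_setOf_eq, Fin.sum_univ_castSucc, cx, cy, ct]
  have hco : ∀ w : Fin (b + (k + 1)) → ℝ, (fun i => w (Fin.cast hc i)) ∈ s.domain →
      ∀ i, |w (Fin.cast hc i)| ≤ R₀ := fun w hw i => by
    have h := norm_le_pi_norm (fun i => w (Fin.cast hc i)) i
    rw [Real.norm_eq_abs] at h
    exact h.trans (hR₀ _ hw)
  have hy : ∀ w : Fin (b + (k + 1)) → ℝ, (fun i => w (Fin.cast hc i)) ∈ s.domain →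
      -(R : ℝ) < w (Fin.natAdd b y0) ∧ w (Fin.natAdd b y0) < R := by
    intro w hw
    have h2 := hco w hw (Fin.castAdd k (Fin.last b))
    rw [cy] at h2
    have h3 : R₀ < R := by
      rw [hR]; push_cast; exact (Nat.le_ceil R₀).trans_lt (lt_add_one _)
    rw [abs_le] at h2
    constructor <;> linarith
  have hmem : ∀ w : Fin (b + (k + 1)) → ℝ, w ∈ (hc ▸ s).domain ↔
      (fun i => w (Fin.cast hc i)) ∈ s.domain := fun w => by rw [cast_domain]; rfl
  refine (orderCells_JJ b (k + 1) m (hc ▸ s) Cs L e p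
    (Fin.cons (some ℓ₂) (fun i => (a i).map fun c => (fun i => c.1 (Fin.castSucc i), c.2)))
    ?_ ?_ ?_ ?_).imp fun c hc' => ⟨hc'.1, by rw [of_cast] at hc'; exact hc'.2⟩
  · refine isBounded_of_forall_abs_le R₀ fun w hw j => ?_
    have h := hco w ((hmem w).1 hw) (Fin.cast hc.symm j)
    simpa using h
  · intro v
    simp only [hCs, Finset.mem_union, Finset.mem_image, Finset.mem_univ, true_and,
      Finset.mem_insert, Finset.mem_singleton]
    induction v using Fin.cases with
    | zero =>
      exact ⟨⟨(Sum.inr (0, -(R : ℚ)), Sum.inl y0), Or.inr (Or.inl rfl), rfl⟩,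
        ⟨(Sum.inl y0, Sum.inr (0, (R : ℚ))), Or.inr (Or.inr rfl), rfl⟩⟩
    | succ i =>
      exact ⟨⟨(bnd (lo i), Sum.inl i.succ), Or.inl (Or.inl (Or.inr ⟨i, rfl⟩)), rfl⟩,
        ⟨(Sum.inl i.succ, bnd (hi i)), Or.inl (Or.inr ⟨i, rfl⟩), rfl⟩⟩
  · ext w
    have hlo : ∀ i, PV (bnd (lo i)) w = _ := fun i => hbv w (lo i) fun c hc => hlohi i c (Or.inl hc)
    have hhi : ∀ i, PV (bnd (hi i)) w = _ := fun i => hbv w (hi i) fun c hc => hlohi i c (Or.inr hc)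
    rw [hmem, hG2]
    show _ ↔ ∀ q ∈ Cs, PV q.1 w < PV q.2 w
    simp only [hCs, Finset.forall_mem_union, Finset.forall_mem_image, Finset.mem_univ,
      true_imp_iff, Finset.forall_mem_insert, Finset.mem_singleton, forall_eq, hrow, hlo, hhi,
      forall_and]
    have hR1 : PV (Sum.inr (0, -(R : ℚ))) w = -(R : ℝ) := by simp [hPV]
    have hR2 : PV (Sum.inr (0, (R : ℚ))) w = (R : ℝ) := by simp [hPV]
    have hv : ∀ v, PV (Sum.inl v) w = w (Fin.natAdd b v) := fun v => by simp [hPV]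
    simp only [hR1, hR2, hv]
    constructor
    · intro h
      have hyy := hy w ((hG2 w).2 ⟨h.1, fun i => ⟨h.2.1 i, h.2.2 i⟩⟩)
      tauto
    · intro h
      tauto
  · intro w hw
    have hD := (hmem w).1 hw
    rw [cast_integrand, hint hD]
    have hlet : ∀ i, (a i).elim (1 : ℝ) (fun c => 1 / (w (Fin.cast hc
        (Fin.natAdd (b + 1) i)) - (∑ i', (c.1 i' : ℝ) * w (Fin.cast hc
        (Fin.castAdd k i')) + c.2))) =
        ((a i).map fun c => ((fun i => c.1 (Fin.castSucc i), c.2) : (Fin b → ℚ) × ℚ)).elim 1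
        (fun c => 1 / (w (Fin.natAdd b i.succ) -
          (∑ i', (c.1 i' : ℝ) * w (Fin.castAdd (k + 1) i') + (c.2 : ℝ)))) := by
      intro i
      rcases h : a i with _ | c
      · rfl
      · simp only [Option.elim, Option.map_some]
        rw [Fin.sum_univ_castSucc, ha i c h, ct]
        simp [cx, cy]
    simp only [hlet, cx, cy, Fin.prod_univ_succ, Fin.cons_zero, Fin.cons_succ, Option.elim_some,
      pow_zero, pow_one]
    rw [← hy0]
    ring

end ReRead

/-- **stub_reRead** (`G₁ b k → closure (JJ b (k + 1))`, line `janus-bands`, skeleton v3).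
Simple pole in `y`, no polynomial factor (`n₂ = 1` forces `n₁ = 0`): transport along
`b + 1 + k = b + (k + 1)` re-reading `y` as the first fibre coordinate with letter `ℓ₂(x')`,
then dissect the resulting order-constrained Janus representation by total-order refinement
(rule 1a) into Janus band representations over the base `x'` with exactly `k + 1` fibres. -/
theorem stub_reRead (JJ : ℕ → ℕ → Set KZ.FormalRep) (G₁ : ℕ → ℕ → Set KZ.FormalRep) (hJJ : ∀ b k, JJ b k = {w : KZ.FormalRep | ∃ (m m' : ℕ) (s : KZ.IntegralRep (b + k)) (M : Fin m' → (Fin b → ℚ) × ℚ) (L : Fin m → (Fin b → ℚ) × ℚ) (e : Fin m → ℕ) (p : MvPolynomial (Fin b) ℚ) (a : Fin k → Option ((Fin b → ℚ) × ℚ)) (lo hi : Fin k → Fin k ⊕ ((Fin b → ℚ) × ℚ)), Bornology.IsBounded s.domain ∧ s.domain = {z | (∀ j, 0 < ∑ i, ((M j).1 i : ℝ) * z (Fin.castAdd k i) + ((M j).2 : ℝ)) ∧ ∀ i, Sum.elim (fun j => z (Fin.natAdd b j)) (fun c => ∑ i', (c.1 i' : ℝ) * z (Fin.castAdd k i') +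 (c.2 : ℝ)) (lo i) < z (Fin.natAdd b i) ∧ z (Fin.natAdd b i) < Sum.elim (fun j => z (Fin.natAdd b j)) (fun c => ∑ i', (c.1 i' : ℝ) * z (Fin.castAdd k i') + (c.2 : ℝ)) (hi i)} ∧ EqOn s.integrand (fun z => MvPolynomial.aeval (fun i => z (Fin.castAdd k i)) p / (∏ j, (∑ i, ((L j).1 i : ℝ) * z (Fin.castAdd k i) + ((L j).2 : ℝ)) ^ e j) * ∏ i, (a i).elim 1 (fun c => 1 / (z (Fin.natAdd b i) - (∑ i', (c.1 i' : ℝ) * z (Fin.castAdd k i') + (c.2 : ℝ))))) s.domain ∧ w = KZ.of s}) (hG₁ : ∀ b k, G₁ b k = {w : KZ.FormalRep | ∃ (m m' n₁ n₂ : ℕ) (s : KZ.IntegralRep (b + 1 + k)) (M : Fin m' → (Fin (b + 1) → ℚ) × ℚ) (L : Fin m → (Fin b → ℚ) × ℚ) (e : Fin m → ℕ) (p : MvPolynomial (Fin b) ℚ) (ℓ₁ ℓ₂ : (Fin b → ℚ) × ℚ) (a : Fin k → Option ((Fin (b + 1) → ℚ) × ℚ)) (lo hi : Fin k → Fin k ⊕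 ((Fin (b + 1) → ℚ) × ℚ)), (n₁ = 0 ∨ n₂ = 0) ∧ n₂ = 1 ∧ (∀ i c, a i = some c → c.1 (Fin.last b) = 0) ∧ (∀ i c, (lo i = Sum.inr c ∨ hi i = Sum.inr c) → (c.1 (Fin.last b) = 0 ∨ c = (Pi.single (Fin.last b) 1, 0))) ∧ Bornology.IsBounded s.domain ∧ s.domain = {z | (∀ j, 0 < ∑ i, ((M j).1 i : ℝ) * z (Fin.castAdd k i) + ((M j).2 : ℝ)) ∧ ∀ i, Sum.elim (fun j => z (Fin.natAdd (b + 1) j)) (fun c => ∑ i', (c.1 i' : ℝ) * z (Fin.castAdd k i') + (c.2 : ℝ)) (lo i) < z (Fin.natAdd (b + 1) i) ∧ z (Fin.natAdd (b + 1) i) < Sum.elim (fun j => z (Fin.natAdd (b + 1) j)) (fun c => ∑ i', (c.1 i' : ℝ) * z (Fin.castAdd k i') + (c.2 : ℝ)) (hi i)} ∧ EqOn s.integrand (fun z => MvPolynomial.aeval (fun i => z (Fin.castAdd k (Fin.castSucc i))) p / (∏ j, (∑ i, ((L j).1 i : ℝ) * z (Fin.castAdd k (Fin.castSucc i)) + ((L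 j).2 : ℝ)) ^ e j) * ((z (Fin.castAdd k (Fin.last b)) - (∑ i, (ℓ₁.1 i : ℝ) * z (Fin.castAdd k (Fin.castSucc i)) + (ℓ₁.2 : ℝ))) ^ n₁ / (z (Fin.castAdd k (Fin.last b)) - (∑ i, (ℓ₂.1 i : ℝ) * z (Fin.castAdd k (Fin.castSucc i)) + (ℓ₂.2 : ℝ))) ^ n₂) * ∏ i, (a i).elim 1 (fun c => 1 / (z (Fin.natAdd (b + 1) i) - (∑ i', (c.1 i' : ℝ) * z (Fin.castAdd k i') + (c.2 : ℝ))))) s.domain ∧ w = KZ.of s}) (b k : ℕ) : ∀ x ∈ G₁ b k, ∃ c ∈ AddSubgroup.closure (JJ b (k + 1)), x - c ∈ KZ.relations := by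
  intro x hx
  rw [hJJ]
  rw [hG₁] at hx
  obtain ⟨m, m', n₁, n₂, s, M, L, e, p, ℓ₁, ℓ₂, a, lo, hi, hn, hn₂, ha, hlohi, hbd, hdom, hint,
    rfl⟩ := hx
  subst hn₂
  obtain rfl : n₁ = 0 := hn.resolve_right one_ne_zero
  exact ReRead.exists_JJ s L e p ℓ₁ ℓ₂ a M lo hi ha hlohi hbd hdom hint

end Summit.KontsevichZagierPeriods.ArrangementNormalForm.JanusBands
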